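import Summits.Ventures.QEC.Census.CertCheckBZ
import HarnessLib

/-!
# A byte-parallel popcount for the kernel replays (SWAR folds + `% 255`) and its correctness
# (plan/CERT-FORMAT.md v1.1 §5.3 C4 leaf; qec-search-10 sizing 2026-08-26 «BZ144 SIZING INPUT»)

The Brouwer–Zimmermann replay (`Census/CertCheckBZ.lean`, type-10) tests every enumerated codeword `c` with
`wtGt wmax c` — clear the lowest set bit `wmax + 1` times. In the kernel (`decide +kernel`) on 144-bit words that leaf
costs ≈ 1.9 ms per end point, ≈ 7× the cost of the enumeration itself (measured, HOME/census/search-10/bz/probes).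
This file provides a cheaper exact weight: `popcFold B x`, the classical byte-parallel population count — three
masked folds `(x &&& M) + ((x >>> w) &&& M)` for `w = 1, 2, 4` with the byte-replicated masks `0x55…`, `0x33…`,
`0x0f…`, then `% 255` (since `256 ≡ 1 (mod 255)` the bytes are summed) — 13 GMP-backed kernel operations per word
(≈ 0.3 ms per end point), and proves

* `popcFold_eq_popc : B ≤ 31 → x < 2 ^ (8 * B) → popcFold B x = popc (8 * B) x`

by a BYTEWISE argument: the folds act independently on the bytes of `x` (bit-level lemmas `ofBytes_and_mrep`,
`ofBytes_shiftRight_and_mrep`; the masks kill every bit that a shift carries across a byte boundary), on one byte the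
three folds compute `popc 8` (`decide` over the 256 bytes), and `% 255` adds the bytes (`ofBytes_mod_255`) without
wrap-around because the total is `≤ 8·B ≤ 248 < 255`. Also: `wtGt_of_lt_popc`, the COMPLETENESS of type-10's `wtGt`
(its soundness `lt_popc_of_wtGt` is in `CertBZWords.lean`), so a fast leaf implies the original one pointwise.
Generic; no `decide` beyond the 256-byte table; axioms standard.
-/

namespace Summit.Ventures.QEC.Census

/-! ## The function -/

/-- The byte-replicated mask `m + 256·m + … ` over `B` bytes. (definition) -/
def mrep (m : ℕ) : ℕ → ℕ
  | 0 => 0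
  | B + 1 => m + 256 * mrep m B

/-- One fold step: add the `w`-shifted word to the word, both masked. (definition) -/
def foldStep (w M x : ℕ) : ℕ := (x &&& M) + ((x >>> w) &&& M)

/-- **Byte-parallel popcount** of a word of at most `B` bytes: 2-bit, 4-bit, 8-bit field sums, then the byte sum by
`% 255`. Equals `popc (8 * B) x` for `x < 2^(8B)`, `B ≤ 31` (`popcFold_eq_popc`). (definition) -/
def popcFold (B x : ℕ) : ℕ :=
  foldStep 4 (mrep 15 B) (foldStep 2 (mrep 51 B) (foldStep 1 (mrep 85 B) x)) % 255

/-- The three folds on a single byte. (definition) -/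
def foldByte (b : ℕ) : ℕ := foldStep 4 15 (foldStep 2 51 (foldStep 1 85 b))

/-! ## Words as byte lists -/

/-- The word with the given little-endian bytes. (definition) -/
def ofBytes : List ℕ → ℕ
  | [] => 0
  | b :: bs => b + 256 * ofBytes bs

/-- The `B` little-endian bytes of `x`. (definition) -/
def toBytes : ℕ → ℕ → List ℕ
  | 0, _ => []
  | B + 1, x => x % 256 :: toBytes B (x / 256)

/-- `toBytes` has `B` entries. -/
theorem length_toBytes : ∀ (B x : ℕ), (toBytes B x).length = B
  | 0, _ => rfl
  | B + 1, x => by simp [toBytes, length_toBytes B]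

/-- Every entry of `toBytes` is a byte. -/
theorem toBytes_lt : ∀ (B x : ℕ), ∀ b ∈ toBytes B x, b < 256
  | 0, _ => by simp [toBytes]
  | B + 1, x => by
    intro b hb
    simp only [toBytes, List.mem_cons] at hb
    rcases hb with rfl | hb
    · exact Nat.mod_lt _ (by norm_num)
    · exact toBytes_lt B _ b hb

/-- A word below `2^(8B)` is the word of its `B` bytes. -/
theorem ofBytes_toBytes : ∀ (B x : ℕ), x < 2 ^ (8 * B) → ofBytes (toBytes B x) = x
  | 0, x, hx => by simp at hx; simp [toBytes, ofBytes, hx]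
  | B + 1, x, hx => by
    have hx' : x / 256 < 2 ^ (8 * B) := by
      rw [Nat.div_lt_iff_lt_mul (by norm_num)]
      have : 2 ^ (8 * (B + 1)) = 2 ^ (8 * B) * 256 := by rw [Nat.mul_succ, pow_add]; norm_num
      omega
    simp only [toBytes, ofBytes, ofBytes_toBytes B (x / 256) hx']
    omega

/-- `mrep m B` is the word of `B` copies of the byte `m`. -/
theorem mrep_eq_ofBytes (m : ℕ) : ∀ B : ℕ, mrep m B = ofBytes (List.replicate B m)
  | 0 => rfl
  | B + 1 => by simp [mrep, ofBytes, List.replicate_succ, mrep_eq_ofBytes m B]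

/-- **Bits of a byte word**: bit `i` of `ofBytes bs` is bit `i % 8` of byte `i / 8` (bytes `< 256`). -/
theorem testBit_ofBytes : ∀ (bs : List ℕ), (∀ b ∈ bs, b < 256) → ∀ i : ℕ,
    (ofBytes bs).testBit i = (bs.getD (i / 8) 0).testBit (i % 8)
  | [], _, i => by simp [ofBytes]
  | b :: bs, h, i => by
    have hb : b < 2 ^ 8 := h b (by simp)
    have ih := testBit_ofBytes bs (fun x hx => h x (by simp [hx]))
    rw [ofBytes, show b + 256 * ofBytes bs = 2 ^ 8 * ofBytes bs + b by omega, Nat.testBit_two_pow_mul_add _ hb]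
    by_cases hi : i < 8
    · rw [if_pos hi, Nat.div_eq_of_lt hi, Nat.mod_eq_of_lt hi]
      simp
    · rw [if_neg hi, ih (i - 8)]
      have h1 : i / 8 = (i - 8) / 8 + 1 := by omega
      have h2 : i % 8 = (i - 8) % 8 := by omega
      rw [h1, h2]
      simp

/-- All entries of a mapped byte list are bytes if the map lands in bytes. -/
private theorem forall_map_lt {f : ℕ → ℕ} (hf : ∀ b, b < 256 → f b < 256) {bs : List ℕ} (h : ∀ b ∈ bs, b < 256) :
    ∀ b ∈ bs.map f, b < 256 := by
  intro b hb
  rw [List.mem_map] at hb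
  obtain ⟨a, ha, rfl⟩ := hb
  exact hf a (h a ha)

/-- `getD` commutes with `map` for a function fixing the default. -/
private theorem getD_map {f : ℕ → ℕ} (hf0 : f 0 = 0) (bs : List ℕ) (j : ℕ) :
    (bs.map f).getD j 0 = f (bs.getD j 0) := by
  rw [List.getD_eq_getElem?_getD, List.getD_eq_getElem?_getD, List.getElem?_map]
  cases bs[j]? <;> simp [hf0]

/-- `getD` of a replicated list. -/
private theorem getD_replicate (B m j : ℕ) : (List.replicate B m).getD j 0 = if j < B then m else 0 := by
  rw [List.getD_eq_getElem?_getD, List.getElem?_replicate]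
  by_cases hj : j < B <;> simp [hj]

/-- A byte mask below `256` whose low bits satisfy a shift condition satisfies it at every bit. -/
theorem mask_shift_ok (m w : ℕ) (hm : m < 256) (h8 : ∀ j < 8, m.testBit j = true → j + w < 8) :
    ∀ j, m.testBit j = true → j + w < 8 := by
  intro j hj
  by_cases hj8 : j < 8
  · exact h8 j hj8 hj
  · have hpow : (256 : ℕ) ≤ 2 ^ j := by
      calc (256 : ℕ) = 2 ^ 8 := by norm_num
        _ ≤ 2 ^ j := Nat.pow_le_pow_right (by norm_num) (by omega)
    rw [Nat.testBit_lt_two_pow (lt_of_lt_of_le hm hpow)] at hj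
    exact absurd hj Bool.false_ne_true

/-- **Masking is bytewise**: `ofBytes bs &&& mrep m B = ofBytes (bs.map (· &&& m))` (`|bs| = B`, bytes `< 256`). -/
theorem ofBytes_and_mrep (m : ℕ) (hm : m < 256) (bs : List ℕ) (h : ∀ b ∈ bs, b < 256) {B : ℕ}
    (hB : bs.length = B) : ofBytes bs &&& mrep m B = ofBytes (bs.map (· &&& m)) := by
  apply Nat.eq_of_testBit_eq
  intro i
  have hf : ∀ b, b < 256 → b &&& m < 256 := fun b _ => lt_of_le_of_lt Nat.and_le_right hm
  rw [Nat.testBit_and, testBit_ofBytes bs h, mrep_eq_ofBytes, testBit_ofBytes _ (by simp; omega),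
    testBit_ofBytes _ (forall_map_lt hf h), getD_map (by simp) bs, Nat.testBit_and, getD_replicate]
  by_cases hj : i / 8 < B
  · simp [hj]
  · have hnone : bs[i / 8]? = none := List.getElem?_eq_none (by omega)
    simp [hj, hnone]

/-- **Shift-then-mask is bytewise** when the mask kills the bits a shift carries across a byte boundary
(`m.testBit j → j + w < 8`): `(ofBytes bs >>> w) &&& mrep m B = ofBytes (bs.map fun b => (b >>> w) &&& m)`. -/
theorem ofBytes_shiftRight_and_mrep (w m : ℕ) (hm : m < 256) (hmw : ∀ j, m.testBit j = true → j + w < 8)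
    (bs : List ℕ) (h : ∀ b ∈ bs, b < 256) {B : ℕ} (hB : bs.length = B) :
    (ofBytes bs >>> w) &&& mrep m B = ofBytes (bs.map fun b => (b >>> w) &&& m) := by
  apply Nat.eq_of_testBit_eq
  intro i
  have hf : ∀ b, b < 256 → (b >>> w) &&& m < 256 := fun b _ => lt_of_le_of_lt Nat.and_le_right hm
  rw [Nat.testBit_and, Nat.testBit_shiftRight, testBit_ofBytes bs h, mrep_eq_ofBytes,
    testBit_ofBytes _ (by simp; omega), testBit_ofBytes _ (forall_map_lt hf h), getD_map (by simp) bs,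
    Nat.testBit_and, Nat.testBit_shiftRight, getD_replicate]
  by_cases hmi : m.testBit (i % 8) = true
  · have hlt : i % 8 + w < 8 := hmw _ hmi
    have h1 : (w + i) / 8 = i / 8 := by omega
    have h2 : (w + i) % 8 = w + i % 8 := by omega
    rw [h1, h2]
    by_cases hj : i / 8 < B
    · simp [hj, hmi]
    · have hnone : bs[i / 8]? = none := List.getElem?_eq_none (by omega)
      simp [hj, hnone]
  · rw [Bool.not_eq_true] at hmi
    by_cases hj : i / 8 < B <;> simp [hj, hmi]

/-- Sums of byte words are bytewise (no carry is claimed: the statement is about the words of the summed lists). -/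
theorem ofBytes_map_add (f g : ℕ → ℕ) : ∀ bs : List ℕ,
    ofBytes (bs.map f) + ofBytes (bs.map g) = ofBytes (bs.map fun b => f b + g b)
  | [] => rfl
  | b :: bs => by
    simp only [List.map_cons, ofBytes]
    have := ofBytes_map_add f g bs
    omega

/-- **One fold step is bytewise**: for a byte mask `m` that kills the carried bits, `foldStep w (mrep m B)` maps the
word of `bs` to the word of the bytes `foldStep w m b`. -/
theorem foldStep_ofBytes (w m : ℕ) (hm : m < 256) (hmw : ∀ j, m.testBit j = true → j + w < 8) (bs : List ℕ)
    (h : ∀ b ∈ bs, b < 256) {B : ℕ} (hB : bs.length = B) :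
    foldStep w (mrep m B) (ofBytes bs) = ofBytes (bs.map (foldStep w m)) := by
  rw [foldStep, ofBytes_and_mrep m hm bs h hB, ofBytes_shiftRight_and_mrep w m hm hmw bs h hB, ofBytes_map_add]
  rfl

/-- `% 255` sums the bytes (`256 ≡ 1`). -/
theorem ofBytes_mod_255 : ∀ bs : List ℕ, ofBytes bs % 255 = bs.sum % 255
  | [] => rfl
  | b :: bs => by
    rw [ofBytes, List.sum_cons, show b + 256 * ofBytes bs = (b + ofBytes bs) + 255 * ofBytes bs by ring,
      Nat.add_mul_mod_self_left, Nat.add_mod, ofBytes_mod_255 bs, ← Nat.add_mod]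

/-! ## `popc` is bytewise -/

/-- `popc` splits at any bit position: the low `a` bits and the rest. -/
theorem popc_add (n : ℕ) : ∀ (a x : ℕ), popc (n + a) x = popc a x + popc n (x / 2 ^ a)
  | 0, x => by simp [popc]
  | a + 1, x => by
    rw [show n + (a + 1) = (n + a) + 1 from rfl, popc, popc_add n a (x / 2), popc, Nat.div_div_eq_div_mul,
      ← pow_succ']
    ring

/-- `popc a` ignores bits `≥ a`. -/
theorem popc_add_mul_two_pow : ∀ (a x y : ℕ), popc a (x + 2 ^ a * y) = popc a x
  | 0, x, y => by simp [popc]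
  | a + 1, x, y => by
    rw [popc, popc, show x + 2 ^ (a + 1) * y = x + 2 * (2 ^ a * y) by ring, Nat.add_mul_mod_self_left,
      Nat.add_mul_div_left _ _ (by norm_num : 0 < 2), popc_add_mul_two_pow a (x / 2) y]

/-- **`popc` of a byte word is the sum of the byte popcounts.** -/
theorem popc_ofBytes : ∀ bs : List ℕ, (∀ b ∈ bs, b < 256) → popc (8 * bs.length) (ofBytes bs) = (bs.map (popc 8)).sum
  | [], _ => by simp [popc, ofBytes]
  | b :: bs, h => by
    have hb : b < 256 := h b (by simp)
    have ih := popc_ofBytes bs (fun x hx => h x (by simp [hx]))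
    have hdiv : (b + 256 * ofBytes bs) / 2 ^ 8 = ofBytes bs := by omega
    have hlow : popc 8 (b + 256 * ofBytes bs) = popc 8 b := by
      rw [show 256 * ofBytes bs = 2 ^ 8 * ofBytes bs by norm_num]
      exact popc_add_mul_two_pow 8 b _
    rw [List.length_cons, show 8 * (bs.length + 1) = 8 * bs.length + 8 by ring, popc_add, ofBytes, hdiv, hlow, ih,
      List.map_cons, List.sum_cons]

/-- `popc n x ≤ n`. -/
theorem popc_le : ∀ (n x : ℕ), popc n x ≤ n
  | 0, _ => le_refl 0
  | n + 1, x => by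
    rw [popc]
    have := popc_le n (x / 2)
    have : x % 2 ≤ 1 := Nat.le_of_lt_succ (Nat.mod_lt x (by norm_num))
    omega

/-- A sum of byte popcounts is at most `8` per byte. -/
theorem sum_map_popc8_le (bs : List ℕ) : (bs.map (popc 8)).sum ≤ 8 * bs.length := by
  induction bs with
  | nil => simp
  | cons b bs ih =>
    simp only [List.map_cons, List.sum_cons, List.length_cons]
    have := popc_le 8 b
    omega

/-! ## The byte table and the main theorem -/

/-- On a single byte the three folds compute the popcount, and every intermediate value is a byte (`decide` over
the 256 bytes). -/
theorem foldByte_table : ∀ b : Fin 256,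
    foldStep 1 85 b.val < 256 ∧ foldStep 2 51 (foldStep 1 85 b.val) < 256 ∧ foldByte b.val = popc 8 b.val := by
  decide +kernel

/-- The first fold lands in bytes. -/
theorem foldStep1_lt (b : ℕ) (hb : b < 256) : foldStep 1 85 b < 256 := (foldByte_table ⟨b, hb⟩).1

/-- The second fold lands in bytes. -/
theorem foldStep2_lt (b : ℕ) (hb : b < 256) : foldStep 2 51 (foldStep 1 85 b) < 256 := (foldByte_table ⟨b, hb⟩).2.1

/-- The three folds of a byte are its popcount. -/
theorem foldByte_eq (b : ℕ) (hb : b < 256) : foldByte b = popc 8 b := (foldByte_table ⟨b, hb⟩).2.2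

/-- **Correctness of the byte-parallel popcount**: for `B ≤ 31` bytes and `x < 2^(8B)`,
`popcFold B x = popc (8 * B) x`. -/
theorem popcFold_eq_popc {B x : ℕ} (hB : B ≤ 31) (hx : x < 2 ^ (8 * B)) : popcFold B x = popc (8 * B) x := by
  -- the bytes of `x`
  set bs := toBytes B x with hbs
  have hlen : bs.length = B := length_toBytes B x
  have h0 : ∀ b ∈ bs, b < 256 := toBytes_lt B x
  have hx' : ofBytes bs = x := ofBytes_toBytes B x hx
  rw [← hx', popcFold]
  -- the masks kill the bits a shift carries across a byte boundary
  have h85 : ∀ j, (85 : ℕ).testBit j = true → j + 1 < 8 := mask_shift_ok 85 1 (by norm_num) (by decide)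
  have h51 : ∀ j, (51 : ℕ).testBit j = true → j + 2 < 8 := mask_shift_ok 51 2 (by norm_num) (by decide)
  have h15 : ∀ j, (15 : ℕ).testBit j = true → j + 4 < 8 := mask_shift_ok 15 4 (by norm_num) (by decide)
  -- fold 1, 2, 3 bytewise
  have e1 := foldStep_ofBytes 1 85 (by norm_num) h85 bs h0 hlen
  have h1 : ∀ b ∈ bs.map (foldStep 1 85), b < 256 := forall_map_lt foldStep1_lt h0
  have hlen1 : (bs.map (foldStep 1 85)).length = B := by rw [List.length_map, hlen]
  have e2 := foldStep_ofBytes 2 51 (by norm_num) h51 _ h1 hlen1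
  have h2 : ∀ b ∈ (bs.map (foldStep 1 85)).map (foldStep 2 51), b < 256 := by
    intro b hb
    simp only [List.map_map, List.mem_map, Function.comp] at hb
    obtain ⟨a, ha, rfl⟩ := hb
    exact foldStep2_lt a (h0 a ha)
  have hlen2 : ((bs.map (foldStep 1 85)).map (foldStep 2 51)).length = B := by rw [List.length_map, hlen1]
  have e3 := foldStep_ofBytes 4 15 (by norm_num) h15 _ h2 hlen2
  rw [e1, e2, e3, ofBytes_mod_255, ← hlen, popc_ofBytes bs h0]
  have hmap : ((bs.map (foldStep 1 85)).map (foldStep 2 51)).map (foldStep 4 15) = bs.map (popc 8) := by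
    simp only [List.map_map]
    apply List.map_congr_left
    intro a ha
    exact foldByte_eq a (h0 a ha)
  rw [hmap, Nat.mod_eq_of_lt]
  have := sum_map_popc8_le bs
  omega

/-! ## The fast leaf implies type-10's leaf -/

/-- **Completeness of `wtGt`** (converse of `lt_popc_of_wtGt`): a word below `2^n` with more than `w` set bits
passes `wtGt w`. -/
theorem wtGt_of_lt_popc (n : ℕ) : ∀ (w c : ℕ), c < 2 ^ n → w < popc n c → wtGt w c = true
  | 0, c, _, hw => by
    rw [wtGt]
    have hc : c ≠ 0 := by rintro rfl; rw [popc_zero] at hw; exact absurd hw (lt_irrefl 0)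
    simpa using hc
  | w + 1, c, hlt, hw => by
    have hc : c ≠ 0 := by rintro rfl; rw [popc_zero] at hw; exact absurd hw (Nat.not_lt_zero _)
    rw [wtGt, Bool.and_eq_true]
    refine ⟨by simpa using hc, wtGt_of_lt_popc n w (c &&& (c - 1)) (lt_of_le_of_lt Nat.and_le_left hlt) ?_⟩
    have := popc_and_pred n hc hlt
    omega

/-- The FAST leaf of the BZ enumeration: empty selection, or byte-parallel weight `> wmax` (`B` bytes), or an
allow-listed word. (definition) -/
def bzLeafFast (B wmax : ℕ) (allow : List ℕ) (u c : ℕ) : Bool :=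
  (u == 0) || Nat.blt wmax (popcFold B c) || allow.elem c

/-- **Fast leaf ⇒ leaf**, pointwise on words of at most `B ≤ 31` bytes. -/
theorem bzLeaf_of_fast {B wmax : ℕ} {allow : List ℕ} {u c : ℕ} (hB : B ≤ 31) (hc : c < 2 ^ (8 * B))
    (h : bzLeafFast B wmax allow u c = true) : bzLeaf wmax allow u c = true := by
  simp only [bzLeafFast, Bool.or_eq_true] at h
  simp only [bzLeaf, Bool.or_eq_true]
  rcases h with (hu | hw) | ha
  · exact Or.inl (Or.inl hu)
  · refine Or.inl (Or.inr (wtGt_of_lt_popc (8 * B) wmax c hc ?_))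
    rw [← popcFold_eq_popc hB hc]
    simpa [Nat.blt_eq] using hw
  · exact Or.inr ha

end Summit.Ventures.QEC.Census
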